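import Mathlib

/-!
# HodgeLocusWeberGenusObstruction — a local obstruction at a ramified prime (hodge-locus census cell, ENGINE A g52)

certified instances and evidence bearing on the general Hodge conjecture; no claim.

Context (cell item G52-A-GCD; nothing here is a statement about any preprint).  In the cell's
transcription of a class-invariant resultant formula (ENGINE A g50/g51, items YZT/YZG), a term
indexed by `n` at a prime `ℓ` dividing both the fundamental discriminant `D₀ < 0` and the
conductor product `t` carries a factor "number of representations of `x = (m - n)/B²` by the
classes of ONE genus of discriminant `D₀`", the genus being selected by a local condition at `ℓ`
that involves an auxiliary integer `κ` with Legendre symbol `(κ/ℓ) = -1`, where `m = |D₀| t`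
(so `ℓ² ∣ m`).  This file proves, in general and with no definitions, the two elementary facts
behind the cell's structural note DERIVATION-GCD-A.md:

* `legendreSym_of_repr_val_one` (Lemma 1): if an integral binary quadratic form `(a, b, c)` with
  `b² - 4ac = ℓ D'`, `ℓ ∤ a` (ℓ an odd prime) represents `ℓ N'` with `ℓ ∤ N'`, then
  `(N'/ℓ) = (a/ℓ)·(-D'/ℓ)`.  (Proof: `4a·ℓN' = z² - ℓD'y²` with `z = 2ax + by`, so `ℓ ∣ z`,
  `4aN' ≡ -D'y² (mod ℓ)` and `ℓ ∤ y`.)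
* `not_repr_of_genus_condition` (Lemma 2, the obstruction): with `ℓ² ∣ m`, `ℓ ∤ n'`, `ℓ ∤ B`,
  `(κ/ℓ) = -1` and the genus equation `(a/ℓ)(-D'/ℓ) = (-κ n'/ℓ)`, NO integers `x, y` satisfy
  `B²·(a x² + b x y + c y²) = m - ℓ n'`.

Consequence recorded in the cell (not formalised here, it concerns the cell's own bookkeeping):
every such term vanishes identically, so two transcriptions of the display that differ only in a
divisor `ℓ` versus `ℓ²` on these terms define the same function — the difference is not testable
by data.  Elementary number theory; our lemma, hence placed under `Summits/`, not `Literature/`.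
-/

namespace HodgeLocusWeberGenusObstruction

/-- Legendre symbols of integers congruent modulo `ℓ` agree. -/
theorem legendreSym_congr {ℓ : ℕ} [Fact ℓ.Prime] {u v : ℤ} (h : (ℓ : ℤ) ∣ u - v) :
    legendreSym ℓ u = legendreSym ℓ v := by
  rw [legendreSym.mod ℓ u, legendreSym.mod ℓ v]
  have : v ≡ u [ZMOD (ℓ : ℤ)] := Int.modEq_iff_dvd.mpr h
  rw [this.symm.eq]

/-- For an odd prime `ℓ`, `4` is a non-zero square modulo `ℓ`, so its Legendre symbol is `1`. -/
theorem legendreSym_four {ℓ : ℕ} [Fact ℓ.Prime] (hℓ : ℓ ≠ 2) : legendreSym ℓ 4 = 1 := by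
  have h2 : ((2 : ℤ) : ZMod ℓ) ≠ 0 := by
    intro h
    have hdvd : (ℓ : ℤ) ∣ 2 := (ZMod.intCast_zmod_eq_zero_iff_dvd 2 ℓ).mp h
    have hle : (ℓ : ℤ) ≤ 2 := Int.le_of_dvd (by norm_num) hdvd
    have hge : 2 ≤ ℓ := (Fact.out : ℓ.Prime).two_le
    omega
  have : (4 : ℤ) = 2 ^ 2 := by norm_num
  rw [this, legendreSym.sq_one' ℓ h2]

/-- An odd prime does not divide `4`. -/
theorem not_dvd_four {ℓ : ℕ} [Fact ℓ.Prime] (hℓ : ℓ ≠ 2) : ¬ (ℓ : ℤ) ∣ 4 := by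
  intro h
  have h' : (ℓ : ℤ) ∣ 2 ^ 2 := by norm_num; exact h
  have hp : Prime (ℓ : ℤ) := Nat.prime_iff_prime_int.mp (Fact.out : ℓ.Prime)
  have h2 : (ℓ : ℤ) ∣ 2 := hp.dvd_of_dvd_pow h'
  have hle : (ℓ : ℤ) ≤ 2 := Int.le_of_dvd (by norm_num) h2
  have hge : 2 ≤ ℓ := (Fact.out : ℓ.Prime).two_le
  omega

/-- **Lemma 1** (valuation-one values of a form whose discriminant is exactly divisible by `ℓ`).
Let `ℓ` be an odd prime and `(a, b, c)` an integral binary quadratic form with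
`b² - 4ac = ℓ·D'` and `ℓ ∤ a`.  If the form represents `ℓ·N'` with `ℓ ∤ N'`, then
`(N'/ℓ) = (a/ℓ)·(-D'/ℓ)`.  (The setting of the cell has `ℓ ∤ D'`; the hypothesis is not needed:
if `ℓ ∣ D'` the other hypotheses are contradictory and both sides vanish formally.) -/
theorem legendreSym_of_repr_val_one {ℓ : ℕ} [Fact ℓ.Prime] (hℓ : ℓ ≠ 2)
    {a b c D' x y N' : ℤ}
    (hD : b ^ 2 - 4 * a * c = ℓ * D') (ha : ¬ (ℓ : ℤ) ∣ a)
    (hQ : a * x ^ 2 + b * x * y + c * y ^ 2 = ℓ * N') (hN' : ¬ (ℓ : ℤ) ∣ N') :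
    legendreSym ℓ N' = legendreSym ℓ a * legendreSym ℓ (-D') := by
  have hp : Prime (ℓ : ℤ) := Nat.prime_iff_prime_int.mp (Fact.out : ℓ.Prime)
  have hℓ0 : (ℓ : ℤ) ≠ 0 := hp.ne_zero
  -- the completed square
  have hz : (2 * a * x + b * y) ^ 2 = ℓ * (4 * a * N' + D' * y ^ 2) := by
    linear_combination (4 * a) * hQ + y ^ 2 * hD
  -- ℓ divides z
  have hℓz : (ℓ : ℤ) ∣ 2 * a * x + b * y := by
    apply hp.dvd_of_dvd_pow (n := 2)
    exact ⟨_, hz⟩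
  obtain ⟨z', hz'⟩ := hℓz
  -- divide the completed square by ℓ
  have hz2 : (ℓ : ℤ) * z' ^ 2 = 4 * a * N' + D' * y ^ 2 := by
    apply mul_left_cancel₀ hℓ0
    have : (ℓ : ℤ) * ((ℓ : ℤ) * z' ^ 2) = ((ℓ : ℤ) * z') ^ 2 := by ring
    rw [this, ← hz', hz]
  -- the congruence 4 a N' ≡ -D' y² (mod ℓ)
  have hcong : (ℓ : ℤ) ∣ 4 * a * N' - (-D' * y ^ 2) := ⟨z' ^ 2, by linear_combination (-1 : ℤ) * hz2⟩
  -- ℓ ∤ y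
  have hy : ¬ (ℓ : ℤ) ∣ y := by
    intro hyd
    have h1 : (ℓ : ℤ) ∣ 4 * a * N' := by
      have : 4 * a * N' = ℓ * z' ^ 2 - D' * y ^ 2 := by linear_combination (-1 : ℤ) * hz2
      rw [this]
      exact dvd_sub (dvd_mul_right _ _) (Dvd.dvd.mul_left (dvd_pow hyd two_ne_zero) _)
    rcases hp.dvd_or_dvd h1 with h4a | hN
    · rcases hp.dvd_or_dvd h4a with h4 | ha'
      · exact not_dvd_four hℓ h4
      · exact ha ha'
    · exact hN' hN
  -- pass to Legendre symbols
  have hsym := legendreSym_congr hcong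
  rw [legendreSym.mul, legendreSym.mul, legendreSym_four hℓ, one_mul, legendreSym.mul] at hsym
  have hy0 : ((y : ℤ) : ZMod ℓ) ≠ 0 := fun h => hy ((ZMod.intCast_zmod_eq_zero_iff_dvd y ℓ).mp h)
  have ha0 : ((a : ℤ) : ZMod ℓ) ≠ 0 := fun h => ha ((ZMod.intCast_zmod_eq_zero_iff_dvd a ℓ).mp h)
  rw [legendreSym.sq_one' ℓ hy0, mul_one] at hsym
  -- hsym : legendreSym ℓ a * legendreSym ℓ N' = legendreSym ℓ (-D')
  have hsq : legendreSym ℓ a ^ 2 = 1 := legendreSym.sq_one ℓ ha0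
  linear_combination (legendreSym ℓ a) * hsym + (-(legendreSym ℓ N')) * hsq

/-- Lemma 1 in the symmetric normalisation `ℓ ∤ c` (swap the roles of `x` and `y`).  Every
primitive form with `ℓ ∣ b² - 4ac` has `ℓ ∤ a` or `ℓ ∤ c`, so the two versions cover all
primitive forms. -/
theorem legendreSym_of_repr_val_one' {ℓ : ℕ} [Fact ℓ.Prime] (hℓ : ℓ ≠ 2)
    {a b c D' x y N' : ℤ}
    (hD : b ^ 2 - 4 * a * c = ℓ * D') (hc : ¬ (ℓ : ℤ) ∣ c)
    (hQ : a * x ^ 2 + b * x * y + c * y ^ 2 = ℓ * N') (hN' : ¬ (ℓ : ℤ) ∣ N') :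
    legendreSym ℓ N' = legendreSym ℓ c * legendreSym ℓ (-D') := by
  have hD2 : b ^ 2 - 4 * c * a = ℓ * D' := by linear_combination hD
  have hQ2 : c * y ^ 2 + b * y * x + a * x ^ 2 = ℓ * N' := by linear_combination hQ
  exact legendreSym_of_repr_val_one hℓ hD2 hc hQ2 hN'

/-- If `ℓ ∣ c` (likewise if `ℓ ∣ a`) then `ℓ ∣ b² - 4ac` forces `ℓ ∣ b`; hence a form with `ℓ ∣ a`,
`ℓ ∣ c` and discriminant divisible by `ℓ` is divisible by `ℓ`, i.e. not primitive.  (So Lemma 1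
or its primed version applies to every primitive form of such a discriminant.) -/
theorem dvd_b_of_dvd_c {ℓ : ℕ} [Fact ℓ.Prime] {a b c D' : ℤ}
    (hD : b ^ 2 - 4 * a * c = ℓ * D') (hc : (ℓ : ℤ) ∣ c) : (ℓ : ℤ) ∣ b := by
  have hp : Prime (ℓ : ℤ) := Nat.prime_iff_prime_int.mp (Fact.out : ℓ.Prime)
  apply hp.dvd_of_dvd_pow (n := 2)
  have : b ^ 2 = ℓ * D' + 4 * a * c := by linear_combination hD
  rw [this]
  obtain ⟨c', rfl⟩ := hc
  exact dvd_add (dvd_mul_right _ _) ⟨4 * a * c', by ring⟩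

/-- **Lemma 2** (the obstruction).  Let `ℓ` be an odd prime, `(a, b, c)` an integral form with
`b² - 4ac = ℓ·D'`, `ℓ ∤ a`; let `ℓ² ∣ m`, `ℓ ∤ n'`, `ℓ ∤ B`, and let `κ` satisfy
`(κ/ℓ) = -1`.  If the form satisfies the genus equation `(a/ℓ)·(-D'/ℓ) = (-κ·n'/ℓ)` (the cell's
reading (iv′) at `ℓ` for the odd-valuation number `c = -κ·ℓ·n'`), then the form does NOT
represent any `X` with `B²·X = m - ℓ·n'`. -/
theorem not_repr_of_genus_condition {ℓ : ℕ} [Fact ℓ.Prime] (hℓ : ℓ ≠ 2)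
    {a b c D' m n' B κ X x y : ℤ}
    (hD : b ^ 2 - 4 * a * c = ℓ * D') (ha : ¬ (ℓ : ℤ) ∣ a)
    (hm : (ℓ : ℤ) ^ 2 ∣ m) (hn' : ¬ (ℓ : ℤ) ∣ n') (hB : ¬ (ℓ : ℤ) ∣ B)
    (hκ : legendreSym ℓ κ = -1)
    (hgenus : legendreSym ℓ a * legendreSym ℓ (-D') = legendreSym ℓ (-κ * n'))
    (hX : B ^ 2 * X = m - ℓ * n')
    (hQ : a * x ^ 2 + b * x * y + c * y ^ 2 = X) : False := by
  have hp : Prime (ℓ : ℤ) := Nat.prime_iff_prime_int.mp (Fact.out : ℓ.Prime)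
  have hℓ0 : (ℓ : ℤ) ≠ 0 := hp.ne_zero
  obtain ⟨m'', hm''⟩ := hm
  -- ℓ ∣ X
  have hℓX : (ℓ : ℤ) ∣ X := by
    have h1 : (ℓ : ℤ) ∣ B ^ 2 * X := ⟨ℓ * m'' - n', by rw [hX, hm'']; ring⟩
    rcases hp.dvd_or_dvd h1 with hB2 | hX'
    · exact absurd (hp.dvd_of_dvd_pow hB2) hB
    · exact hX'
  obtain ⟨X', hX'⟩ := hℓX
  -- B² X' = ℓ m'' - n'
  have hW : B ^ 2 * X' = ℓ * m'' - n' := by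
    apply mul_left_cancel₀ hℓ0
    have : (ℓ : ℤ) * (B ^ 2 * X') = B ^ 2 * X := by rw [hX']; ring
    rw [this, hX, hm'']; ring
  -- ℓ ∤ X'
  have hX'n : ¬ (ℓ : ℤ) ∣ X' := by
    intro h
    apply hn'
    have : n' = ℓ * m'' - B ^ 2 * X' := by linear_combination hW
    rw [this]
    exact dvd_sub (dvd_mul_right _ _) (Dvd.dvd.mul_left h _)
  -- Lemma 1: (X'/ℓ) = (a/ℓ)(-D'/ℓ) = (-κ n'/ℓ) = -( -n'/ℓ)
  have hQ' : a * x ^ 2 + b * x * y + c * y ^ 2 = ℓ * X' := by rw [hQ, hX']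
  have h1 : legendreSym ℓ X' = legendreSym ℓ a * legendreSym ℓ (-D') :=
    legendreSym_of_repr_val_one hℓ hD ha hQ' hX'n
  rw [hgenus, show (-κ * n' : ℤ) = κ * (-n') by ring, legendreSym.mul, hκ] at h1
  -- the congruence B² X' ≡ -n' (mod ℓ): (X'/ℓ) = (-n'/ℓ)
  have hcong : (ℓ : ℤ) ∣ B ^ 2 * X' - (-n') := ⟨m'', by linear_combination hW⟩
  have h2 := legendreSym_congr hcong
  have hB0 : ((B : ℤ) : ZMod ℓ) ≠ 0 := fun h => hB ((ZMod.intCast_zmod_eq_zero_iff_dvd B ℓ).mp h)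
  rw [legendreSym.mul, legendreSym.sq_one' ℓ hB0, one_mul] at h2
  -- so (-n'/ℓ) = -(-n'/ℓ), i.e. (-n'/ℓ) = 0, i.e. ℓ ∣ n'
  have h3 : legendreSym ℓ (-n') = -1 * legendreSym ℓ (-n') := h2.symm.trans h1
  have h0 : legendreSym ℓ (-n') = 0 := by omega
  have : ((-n' : ℤ) : ZMod ℓ) = 0 := (legendreSym.eq_zero_iff ℓ (-n')).mp h0
  have : (ℓ : ℤ) ∣ -n' := (ZMod.intCast_zmod_eq_zero_iff_dvd (-n') ℓ).mp this
  exact hn' (dvd_neg.mp this)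

/-- Lemma 2 as a non-representation statement. -/
theorem not_exists_repr_of_genus_condition {ℓ : ℕ} [Fact ℓ.Prime] (hℓ : ℓ ≠ 2)
    {a b c D' m n' B κ X : ℤ}
    (hD : b ^ 2 - 4 * a * c = ℓ * D') (ha : ¬ (ℓ : ℤ) ∣ a)
    (hm : (ℓ : ℤ) ^ 2 ∣ m) (hn' : ¬ (ℓ : ℤ) ∣ n') (hB : ¬ (ℓ : ℤ) ∣ B)
    (hκ : legendreSym ℓ κ = -1)
    (hgenus : legendreSym ℓ a * legendreSym ℓ (-D') = legendreSym ℓ (-κ * n'))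
    (hX : B ^ 2 * X = m - ℓ * n') :
    ¬ ∃ x y : ℤ, a * x ^ 2 + b * x * y + c * y ^ 2 = X := by
  rintro ⟨x, y, hQ⟩
  exact not_repr_of_genus_condition hℓ hD ha hm hn' hB hκ hgenus hX hQ

end HodgeLocusWeberGenusObstruction
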